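import Mathlib
import Summits.Ventures.PercRepro2.V2SP
import Summits.Ventures.PercRepro2.Tail2DCount
import Summits.Ventures.PercRepro2.Tail2DThreePoint
import Summits.Ventures.PercRepro2.Tail2DP2Series

/-!
# Two disjoint red paths are rarer than a red path together with a blue path (seat mine-b, cell pub-perc-repro2)

For every pattern `s` of the cell's series–parallel grammar, uniformly two-coloured, the number of
configurations with red flow `≥ 2` (two edge-disjoint red `s–t` paths, the disjoint occurrence
`A ∘ A` of the red connection event `A`) is at most the number of configurations with red flow `≥ 1`
AND blue flow `≥ 1` (a red path and a blue path, `A ∩ B` with `B` the blue connection, i.e. «the red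
edges contain no `s–t` cut»):

  `#{r ≥ 2} ≤ #{r ≥ 1 ∧ b ≥ 1}`   (`disjoint_le_conn`).

In probabilistic terms `P(A ∘ A) ≤ P(A ∩ B)`: the van den Berg–Kesten bound `P(A ∘ A) ≤ P(A)²` for
two copies of the connection event factors through the red–blue intersection, which Harris bounds by
the same `P(A)²` (`A` increasing, `B` decreasing). Neither classical inequality implies it.

PROOF by induction over the grammar, with the colour swap as the relay: on an atom the left side is
`0`; a series composition multiplies both sides (`min (r₁, r₂) ≥ 2` iff both `≥ 2`, likewise the
intersection); for a parallel composition write `P = #{r = 0}`, `Q = #{r = 1}`, `Z = #{r = b = 0}`,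
`M = #Conf` of the two factors: `#{r ≥ 2} = MM' − PP' − QP' − PQ'` and
`#{r ≥ 1 ∧ b ≥ 1} = MM' − 2PP' + ZZ'` (using `#{b = 0} = #{r = 0}` by the colour swap), and the
induction hypothesis `#{r ≥ 2} ≤ #{r ≥ 1 ∧ b ≥ 1}` of a factor reads `P ≤ Q + Z`; then
`QP' + PQ' + ZZ' − PP' ≥ (P − Z)(P' − Z') ≥ 0`. The inequality is asymptotically tight on the wide
bundles (`(2^D − 1 − D) / (2^D − 2)`), and holds on every two-terminal graph tested (registry §34.13).
-/

namespace Summit.Ventures.PercRepro2.Tail2D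

open V2Closure

/-- the colour swap of a configuration: red ↔ blue on every free edge -/
def swapConf : ∀ s : V2Closure.SP, s.Conf → s.Conf
  | .free => fun c => !c
  | .pin => fun u => u
  | .absent => fun u => u
  | .ser s t => fun p => (swapConf s p.1, swapConf t p.2)
  | .par s t => fun p => (swapConf s p.1, swapConf t p.2)

/-- the swap is an involution -/
lemma swapConf_swapConf : ∀ (s : V2Closure.SP) (y : s.Conf), swapConf s (swapConf s y) = y
  | .free, c => by simp [swapConf]
  | .pin, _ => rfl
  | .absent, _ => rfl
  | .ser s t, ⟨a, b⟩ => by simp only [swapConf, swapConf_swapConf s a, swapConf_swapConf t b]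
  | .par s t, ⟨a, b⟩ => by simp only [swapConf, swapConf_swapConf s a, swapConf_swapConf t b]

/-- the swap exchanges the red and blue flows -/
lemma rLab_swapConf : ∀ (s : V2Closure.SP) (y : s.Conf), s.rLab (swapConf s y) = s.bLab y
  | .free, c => by cases c <;> simp [swapConf, SP.rLab, SP.bLab]
  | .pin, _ => rfl
  | .absent, _ => rfl
  | .ser s t, ⟨a, b⟩ => by
    simp only [swapConf, SP.rLab, SP.bLab, serR, serB]; rw [rLab_swapConf s a, rLab_swapConf t b]
  | .par s t, ⟨a, b⟩ => by
    simp only [swapConf, SP.rLab, SP.bLab, parR, parB]; rw [rLab_swapConf s a, rLab_swapConf t b]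

/-- the swap exchanges the blue and red flows -/
lemma bLab_swapConf (s : V2Closure.SP) (y : s.Conf) : s.bLab (swapConf s y) = s.rLab y := by
  have := rLab_swapConf s (swapConf s y)
  rw [swapConf_swapConf] at this
  exact this.symm

/-- the number of configurations with blue flow `0` equals the number with red flow `0` -/
lemma card_b0_eq_r0 (s : V2Closure.SP) :
    (Finset.univ.filter (fun y : s.Conf => s.bLab y = 0)).card = (Finset.univ.filter (fun y : s.Conf => s.rLab y = 0)).card := by
  refine Finset.card_bij' (fun y _ => swapConf s y) (fun y _ => swapConf s y) ?_ ?_ ?_ ?_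
  · intro y hy; simp only [Finset.mem_filter, Finset.mem_univ, true_and] at hy ⊢; rw [rLab_swapConf]; exact hy
  · intro y hy; simp only [Finset.mem_filter, Finset.mem_univ, true_and] at hy ⊢; rw [bLab_swapConf]; exact hy
  · intro y _; exact swapConf_swapConf s y
  · intro y _; exact swapConf_swapConf s y

section Counts

variable (s : V2Closure.SP)

/-- `#{r ≥ 2} + #{r = 0} + #{r = 1} = #Conf` -/
lemma card_r2_add (s : V2Closure.SP) :
    (Finset.univ.filter (fun y : s.Conf => 2 ≤ s.rLab y)).card + (Finset.univ.filter (fun y : s.Conf => s.rLab y = 0)).card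
      + (Finset.univ.filter (fun y : s.Conf => s.rLab y = 1)).card = Fintype.card s.Conf := by
  rw [Finset.card_filter, Finset.card_filter, Finset.card_filter, ← Finset.card_univ, Finset.card_eq_sum_ones,
    ← Finset.sum_add_distrib, ← Finset.sum_add_distrib]
  refine Finset.sum_congr rfl (fun y _ => ?_)
  split_ifs <;> omega

/-- `#{r ≥ 1 ∧ b ≥ 1} + #{r = 0} + #{b = 0} = #Conf + #{r = b = 0}` -/
lemma card_conn_add (s : V2Closure.SP) :
    (Finset.univ.filter (fun y : s.Conf => 1 ≤ s.rLab y ∧ 1 ≤ s.bLab y)).card + (Finset.univ.filter (fun y : s.Conf => s.rLab y = 0)).card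
      + (Finset.univ.filter (fun y : s.Conf => s.bLab y = 0)).card
      = Fintype.card s.Conf + (Finset.univ.filter (fun y : s.Conf => s.rLab y = 0 ∧ s.bLab y = 0)).card := by
  rw [Finset.card_filter, Finset.card_filter, Finset.card_filter, Finset.card_filter, ← Finset.card_univ, Finset.card_eq_sum_ones,
    ← Finset.sum_add_distrib, ← Finset.sum_add_distrib, ← Finset.sum_add_distrib]
  refine Finset.sum_congr rfl (fun y _ => ?_)
  split_ifs <;> omega

/-- `#{r = b = 0} ≤ #{r = 0}` -/
lemma card_z_le (s : V2Closure.SP) :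
    (Finset.univ.filter (fun y : s.Conf => s.rLab y = 0 ∧ s.bLab y = 0)).card ≤ (Finset.univ.filter (fun y : s.Conf => s.rLab y = 0)).card :=
  Finset.card_le_card (fun y hy => by simp only [Finset.mem_filter] at hy ⊢; exact ⟨hy.1, hy.2.1⟩)

end Counts

section Product

variable (s t : V2Closure.SP)

/-- on a product of configuration spaces, a sum of a product of indicators is the product of the sums -/
lemma sum_prod_ite (p : s.Conf → Prop) (q : t.Conf → Prop) [DecidablePred p] [DecidablePred q] :
    (∑ y : s.Conf × t.Conf, if p y.1 ∧ q y.2 then 1 else 0)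
      = (∑ a : s.Conf, if p a then 1 else 0) * (∑ b : t.Conf, if q b then 1 else 0) := by
  rw [Finset.sum_mul_sum, ← Fintype.sum_prod_type']
  refine Finset.sum_congr rfl (fun y _ => ?_)
  split_ifs <;> simp_all

/-- series: `#{r ≥ 2}` multiplies -/
lemma card_r2_ser :
    (Finset.univ.filter (fun y : (V2Closure.SP.ser s t).Conf => 2 ≤ (V2Closure.SP.ser s t).rLab y)).card
      = (Finset.univ.filter (fun y : s.Conf => 2 ≤ s.rLab y)).card * (Finset.univ.filter (fun y : t.Conf => 2 ≤ t.rLab y)).card := by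
  simp only [Finset.card_filter]
  rw [← sum_prod_ite s t (fun a => 2 ≤ s.rLab a) (fun b => 2 ≤ t.rLab b)]
  refine Finset.sum_congr rfl (fun y _ => ?_)
  simp only [SP.rLab, serR]
  split_ifs <;> omega

/-- series: `#{r ≥ 1 ∧ b ≥ 1}` multiplies -/
lemma card_conn_ser :
    (Finset.univ.filter (fun y : (V2Closure.SP.ser s t).Conf => 1 ≤ (V2Closure.SP.ser s t).rLab y ∧ 1 ≤ (V2Closure.SP.ser s t).bLab y)).card
      = (Finset.univ.filter (fun y : s.Conf => 1 ≤ s.rLab y ∧ 1 ≤ s.bLab y)).card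
        * (Finset.univ.filter (fun y : t.Conf => 1 ≤ t.rLab y ∧ 1 ≤ t.bLab y)).card := by
  simp only [Finset.card_filter]
  rw [← sum_prod_ite s t (fun a => 1 ≤ s.rLab a ∧ 1 ≤ s.bLab a) (fun b => 1 ≤ t.rLab b ∧ 1 ≤ t.bLab b)]
  refine Finset.sum_congr rfl (fun y _ => ?_)
  simp only [SP.rLab, SP.bLab, serR, serB]
  split_ifs <;> omega

/-- parallel: `#{r ≥ 2} + PP' + QP' + PQ' = MM'` -/
lemma card_r2_par :
    (Finset.univ.filter (fun y : (V2Closure.SP.par s t).Conf => 2 ≤ (V2Closure.SP.par s t).rLab y)).card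
      + (Finset.univ.filter (fun y : s.Conf => s.rLab y = 0)).card * (Finset.univ.filter (fun y : t.Conf => t.rLab y = 0)).card
      + (Finset.univ.filter (fun y : s.Conf => s.rLab y = 1)).card * (Finset.univ.filter (fun y : t.Conf => t.rLab y = 0)).card
      + (Finset.univ.filter (fun y : s.Conf => s.rLab y = 0)).card * (Finset.univ.filter (fun y : t.Conf => t.rLab y = 1)).card
      = Fintype.card s.Conf * Fintype.card t.Conf := by
  simp only [Finset.card_filter]
  rw [← sum_prod_ite s t (fun a => s.rLab a = 0) (fun b => t.rLab b = 0), ← sum_prod_ite s t (fun a => s.rLab a = 1) (fun b => t.rLab b = 0),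
    ← sum_prod_ite s t (fun a => s.rLab a = 0) (fun b => t.rLab b = 1), ← Fintype.card_prod, ← Finset.card_univ, Finset.card_eq_sum_ones]
  change (∑ y : s.Conf × t.Conf, if 2 ≤ s.rLab y.1 + t.rLab y.2 then 1 else 0) + _ + _ + _ = _
  rw [← Finset.sum_add_distrib, ← Finset.sum_add_distrib, ← Finset.sum_add_distrib]
  refine Finset.sum_congr rfl (fun y _ => ?_)
  split_ifs <;> omega

/-- parallel: `#{r ≥ 1 ∧ b ≥ 1} + PP' + P_b P_b' = MM' + ZZ'` -/
lemma card_conn_par :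
    (Finset.univ.filter (fun y : (V2Closure.SP.par s t).Conf => 1 ≤ (V2Closure.SP.par s t).rLab y ∧ 1 ≤ (V2Closure.SP.par s t).bLab y)).card
      + (Finset.univ.filter (fun y : s.Conf => s.rLab y = 0)).card * (Finset.univ.filter (fun y : t.Conf => t.rLab y = 0)).card
      + (Finset.univ.filter (fun y : s.Conf => s.bLab y = 0)).card * (Finset.univ.filter (fun y : t.Conf => t.bLab y = 0)).card
      = Fintype.card s.Conf * Fintype.card t.Conf
        + (Finset.univ.filter (fun y : s.Conf => s.rLab y = 0 ∧ s.bLab y = 0)).card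
          * (Finset.univ.filter (fun y : t.Conf => t.rLab y = 0 ∧ t.bLab y = 0)).card := by
  simp only [Finset.card_filter]
  rw [← sum_prod_ite s t (fun a => s.rLab a = 0) (fun b => t.rLab b = 0), ← sum_prod_ite s t (fun a => s.bLab a = 0) (fun b => t.bLab b = 0),
    ← sum_prod_ite s t (fun a => s.rLab a = 0 ∧ s.bLab a = 0) (fun b => t.rLab b = 0 ∧ t.bLab b = 0), ← Fintype.card_prod, ← Finset.card_univ,
    Finset.card_eq_sum_ones]
  change (∑ y : s.Conf × t.Conf, if 1 ≤ s.rLab y.1 + t.rLab y.2 ∧ 1 ≤ s.bLab y.1 + t.bLab y.2 then 1 else 0) + _ + _ = _ + _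
  rw [← Finset.sum_add_distrib, ← Finset.sum_add_distrib, ← Finset.sum_add_distrib]
  refine Finset.sum_congr rfl (fun y _ => ?_)
  split_ifs <;> omega

end Product

/-- **two edge-disjoint red paths are rarer than a red path together with a blue path**, on every
pattern of the grammar: `#{r ≥ 2} ≤ #{r ≥ 1 ∧ b ≥ 1}` -/
theorem disjoint_le_conn : ∀ s : V2Closure.SP,
    (Finset.univ.filter (fun y : s.Conf => 2 ≤ s.rLab y)).card
      ≤ (Finset.univ.filter (fun y : s.Conf => 1 ≤ s.rLab y ∧ 1 ≤ s.bLab y)).card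
  | .free => by decide
  | .pin => by decide
  | .absent => by decide
  | .ser s t => by
    rw [card_r2_ser, card_conn_ser]
    exact Nat.mul_le_mul (disjoint_le_conn s) (disjoint_le_conn t)
  | .par s t => by
    have hs := disjoint_le_conn s
    have ht := disjoint_le_conn t
    have e1 := card_r2_par s t
    have e2 := card_conn_par s t
    have a1 := card_r2_add s
    have a2 := card_r2_add t
    have b1 := card_conn_add s
    have b2 := card_conn_add t
    have z1 := card_z_le s
    have z2 := card_z_le t
    rw [card_b0_eq_r0 s] at e2 b1
    rw [card_b0_eq_r0 t] at e2 b2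
    set D := (Finset.univ.filter (fun y : (V2Closure.SP.par s t).Conf => 2 ≤ (V2Closure.SP.par s t).rLab y)).card
    set C := (Finset.univ.filter (fun y : (V2Closure.SP.par s t).Conf =>
      1 ≤ (V2Closure.SP.par s t).rLab y ∧ 1 ≤ (V2Closure.SP.par s t).bLab y)).card
    set Ds := (Finset.univ.filter (fun y : s.Conf => 2 ≤ s.rLab y)).card
    set Dt := (Finset.univ.filter (fun y : t.Conf => 2 ≤ t.rLab y)).card
    set Cs := (Finset.univ.filter (fun y : s.Conf => 1 ≤ s.rLab y ∧ 1 ≤ s.bLab y)).card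
    set Ct := (Finset.univ.filter (fun y : t.Conf => 1 ≤ t.rLab y ∧ 1 ≤ t.bLab y)).card
    set P := (Finset.univ.filter (fun y : s.Conf => s.rLab y = 0)).card
    set P' := (Finset.univ.filter (fun y : t.Conf => t.rLab y = 0)).card
    set Q := (Finset.univ.filter (fun y : s.Conf => s.rLab y = 1)).card
    set Q' := (Finset.univ.filter (fun y : t.Conf => t.rLab y = 1)).card
    set Z := (Finset.univ.filter (fun y : s.Conf => s.rLab y = 0 ∧ s.bLab y = 0)).card
    set Z' := (Finset.univ.filter (fun y : t.Conf => t.rLab y = 0 ∧ t.bLab y = 0)).card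
    set M := Fintype.card s.Conf
    set M' := Fintype.card t.Conf
    -- the induction hypotheses say `P ≤ Q + Z` and `P' ≤ Q' + Z'`; the goal `D ≤ C` is `PP' ≤ QP' + PQ' + ZZ'`
    have hq : (P : ℤ) ≤ Q + Z := by omega
    have hq' : (P' : ℤ) ≤ Q' + Z' := by omega
    have hz1' : (Z : ℤ) ≤ P := by exact_mod_cast z1
    have hz2' : (Z' : ℤ) ≤ P' := by exact_mod_cast z2
    have key : (P : ℤ) * P' ≤ Q * P' + P * Q' + Z * Z' := by
      nlinarith [mul_nonneg (sub_nonneg.2 hz1') (sub_nonneg.2 hz2'), mul_le_mul_of_nonneg_right hq (Int.natCast_nonneg P'),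
        mul_le_mul_of_nonneg_left hq' (Int.natCast_nonneg P)]
    have e1' : (D : ℤ) + P * P' + Q * P' + P * Q' = M * M' := by exact_mod_cast e1
    have e2' : (C : ℤ) + P * P' + P * P' = M * M' + Z * Z' := by exact_mod_cast e2
    have : (D : ℤ) ≤ C := by linarith
    exact_mod_cast this

/-- the same in the vocabulary of `Tail2DP2Series`: `stat s (2 ≤ r) ≤ stat s (1 ≤ r ∧ 1 ≤ b)` -/
theorem stat_disjoint_le_conn (s : V2Closure.SP) : stat s (fun r _ => 2 ≤ r) ≤ stat s (fun r b => 1 ≤ r ∧ 1 ≤ b) :=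
  disjoint_le_conn s

end Summit.Ventures.PercRepro2.Tail2D
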